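import Mathlib
import Summits.CriticalPhenomena.Ising3DConformalLimit.Theorems.PrecisionLaplacianInverseMFerromagnetSeriesParallel
import Summits.CriticalPhenomena.Ising3DConformalLimit.Theorems.PrecisionLaplacianInverseMFerromagnetDbLocal
import HarnessLib

/-!
# DB♯ propagates along series–parallel extensions from ANY base class; the ≤4-site-core corollary
# (crux `PrecisionLaplacian.InverseMFerromagnet`, stmt-CriticalPhenomena-4798, line `Sketch`, lead c3, wave 5)

`helper_db_spClosure`: if every structure of a base class satisfies DB♯ for all nonnegative couplings, so does
every structure in its series–parallel closure `IsSPClosure base` (pendant / parallel / subdivide / relabel) —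
the four landed steps `helper_sp_pendant/parallel/subdivide/relabel` never use series–parallelness.
`helper_im_coreLeFour`: with the base "at most four sites" (DB♯ there is `helper_db_le_four`, i.e. IM on ≤ 5 sites
self-improved locally) this gives IM, indeed DB♯, for every structure REDUCIBLE TO ≤ 4 SITES by deleting pendant
sites, suppressing degree-2 sites and merging parallel bonds: e.g. every subdivision of `K₄` with pendant trees
attached (treewidth 3) — strictly beyond T-SP (`helper_im_seriesParallel`, base = bondless).
-/

namespace Summit.CriticalPhenomena.Ising3DConformalLimit.Cruxes.InverseMFerromagnet.PartialCovarianceLadder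

open Literature.Probability.LatticeModels Finset Matrix

noncomputable section

/-- **DB♯ propagates from any base class to its series–parallel closure.** [folklore] -/
theorem helper_db_spClosure :
    ∀ (base : (n m : ℕ) → (Fin m → Finset (Fin n)) → Prop),
      (∀ n m C, base n m C → ∀ i, (C i).card = 2) →
      (∀ n m C, base n m C → ∀ (K : Fin m → ℝ), (∀ i, 0 ≤ K i) → ∀ x y : Fin n, x ≠ y →
        (Matrix.of fun p q : Fin n => gksExpect Finset.univ K C (fun ω => spinAt p ω * spinAt q ω))⁻¹ x y ≤
          -(Real.tanh (∑ i ∈ Finset.univ.filter (fun i => C i = {x, y}), K i)) /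
            (1 + Real.tanh (∑ i ∈ Finset.univ.filter (fun i => C i = {x, y}), K i) ^ 2
              - 2 * Real.tanh (∑ i ∈ Finset.univ.filter (fun i => C i = {x, y}), K i)
                * gksExpect Finset.univ K C (fun ω => spinAt x ω * spinAt y ω))) →
      ∀ (n m : ℕ) (C : Fin m → Finset (Fin n)), IsSPClosure base n m C →
        ∀ (K : Fin m → ℝ), (∀ i, 0 ≤ K i) → ∀ x y : Fin n, x ≠ y →
        (Matrix.of fun p q : Fin n => gksExpect Finset.univ K C (fun ω => spinAt p ω * spinAt q ω))⁻¹ x y ≤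
          -(Real.tanh (∑ i ∈ Finset.univ.filter (fun i => C i = {x, y}), K i)) /
            (1 + Real.tanh (∑ i ∈ Finset.univ.filter (fun i => C i = {x, y}), K i) ^ 2
              - 2 * Real.tanh (∑ i ∈ Finset.univ.filter (fun i => C i = {x, y}), K i)
                * gksExpect Finset.univ K C (fun ω => spinAt x ω * spinAt y ω)) := by
  intro base hcard hbase n m C h
  induction h with
  | base C h => exact hbase _ _ C h
  | pendant h v C' hold hnew ih =>
      exact helper_sp_pendant _ _ _ (isSPClosure_card_eq_two base hcard _ _ _ h) ih v C' hold hnew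
  | parallel h i₀ C' hold hnew ih =>
      exact helper_sp_parallel _ _ _ (isSPClosure_card_eq_two base hcard _ _ _ h) ih i₀ C' hold hnew
  | subdivide h i₀ a b hab hi₀ C' hold hi₀' hnew ih =>
      exact helper_sp_subdivide _ _ _ (isSPClosure_card_eq_two base hcard _ _ _ h) ih i₀ a b hab hi₀ C' hold hi₀' hnew
  | relabel h eV eι C' hC' ih =>
      exact helper_sp_relabel _ _ _ (isSPClosure_card_eq_two base hcard _ _ _ h) ih eV eι C' hC'

/-- **IM (indeed DB♯) for every structure whose series–parallel reduction core has at most four sites**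
(closure of the base "n ≤ 4, pair bonds" under pendant / parallel / subdivide / relabel; base DB♯ =
`helper_db_le_four`). [folklore] -/
theorem helper_im_coreLeFour :
    ∀ (n m : ℕ) (K : Fin m → ℝ) (C : Fin m → Finset (Fin n)),
      IsSPClosure (fun n _ C => n ≤ 4 ∧ ∀ i, (C i).card = 2) n m C → (∀ i, 0 ≤ K i) →
      ∀ x y : Fin n, x ≠ y →
        (Matrix.of fun p q : Fin n => gksExpect Finset.univ K C (fun ω => spinAt p ω * spinAt q ω))⁻¹ x y ≤ 0 := by
  intro n m K C hcl hK x y hxy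
  have hdb := helper_db_spClosure (fun n _ C => n ≤ 4 ∧ ∀ i, (C i).card = 2)
    (fun _ _ _ hb => hb.2) (fun n m C hb K hK x y hxy => helper_db_le_four n m K C hb.1 hK hb.2 x y hxy)
    n m C hcl K hK x y hxy
  refine hdb.trans ?_
  set t := Real.tanh (∑ i ∈ Finset.univ.filter (fun i => C i = {x, y}), K i) with ht
  have hs : 0 ≤ ∑ i ∈ Finset.univ.filter (fun i => C i = {x, y}), K i :=
    Finset.sum_nonneg fun i _ => hK i
  have ht0 : 0 ≤ t := by
    rw [ht, Real.tanh_eq_sinh_div_cosh]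
    exact div_nonneg (Real.sinh_nonneg_iff.2 hs) (Real.cosh_pos _).le
  have ht1 : t < 1 := by rw [ht]; exact Real.tanh_lt_one _
  have hG : gksExpect Finset.univ K C (fun ω => spinAt x ω * spinAt y ω) ≤ 1 :=
    tsp_gksExpect_pair_le_one K C x y
  have hden : 0 < 1 + t ^ 2 - 2 * t * gksExpect Finset.univ K C (fun ω => spinAt x ω * spinAt y ω) := by
    nlinarith [mul_le_mul_of_nonneg_left hG ht0, pow_pos (sub_pos.2 ht1) 2]
  rw [neg_div]
  exact neg_nonpos.mpr (div_nonneg ht0 hden.le)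

end

end Summit.CriticalPhenomena.Ising3DConformalLimit.Cruxes.InverseMFerromagnet.PartialCovarianceLadder
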